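import Summits.Ventures.DiscreteObjects.UnitDistance.QuadraticFieldsAtlas
import Summits.Ventures.DiscreteObjects.UnitDistance.BipartitePlanes
import Summits.Ventures.DiscreteObjects.UnitDistance.PlaneChromaticSummary

/-!
# Field planes and target (U): one summary for the census table (cell `pub-namedobj`, seat udg g11)

Framing (verbatim for the cell): lottery ticket; floor = certified bounds/negative ranges.

One conjunction assembling udg g11's kernel results on `χ(K²)` for real multiquadratic `K = ℚ(√d : d ∈ S)`
(`MultiquadraticCriterion`, `FieldPlanesCriterion`, `ThreeAdicCriterion`, `PadicCriterion`, `OddCycles`, `BipartitePlanes`,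
`QuadraticFieldsAtlas`) next to the kernel range `χ(ℝ²) ∈ {5, 6, 7}` (udg g9): VALUES — the quadratic dichotomy and the
exact-`3` family; the multiquadratic bipartite `iff`; `χ ≤ 4` on all `[−1]`-free square-class patterns; `χ ≤ 5` on every
COVERED `S` — and the CENSUS consequence for target (U): a 6-chromatic unit-distance graph (`¬ 5`-colourable) has a coordinate
outside `K_S` for every covered `S`: Heule's `ℚ(√3,√5,√11)`, every `ℚ(√d)` with `0 < d < 167`, `d ≠ 164`, and all biquadratic
`ℚ(√a,√b)`, `a < b ≤ 30` square-free, except the six survivors.  Words: quadratic values = replication (Woodall 1973, Johnson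
1987, Fischer 1990, Madore 2015); odd-prime bounds = explicit instances of Madore 2015 Cor. 3.2; the 2-adic criterion, the odd
cycles, the `iff` and the atlas = ours as far as searched (PROVISIONAL).  Not a `χ(ℝ²)` claim; nothing here is literature.
-/

noncomputable section

namespace Summit.Ventures.DiscreteObjects.UnitDistance

open SimpleGraph IntermediateField
open scoped IntermediateField

/-- FIELD PLANES × TARGET (U): the summary conjunction (see the module docstring for the reading). -/
theorem fieldPlane_census_summary :
    -- the kernel range of the plane (udg g9)
    (planeUnitDistanceGraph.chromaticNumber = 5 ∨ planeUnitDistanceGraph.chromaticNumber = 6 ∨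
        planeUnitDistanceGraph.chromaticNumber = 7) ∧
    -- quadratic dichotomy and the exact-three family
    (∀ d : ℕ, d % 4 ≠ 0 →
        ((planeUnitDistanceGraph.induce (fieldPoints ℚ⟮Real.sqrt d⟯)).chromaticNumber = 2 ↔ d % 4 ≠ 3)) ∧
    (∀ d : ℕ, d % 4 = 3 → (d % 3 = 1 ∨ d % 9 = 3 ∨ d % 9 = 6) →
        (planeUnitDistanceGraph.induce (fieldPoints ℚ⟮Real.sqrt d⟯)).chromaticNumber = 3) ∧
    -- multiquadratic: bipartite iff ramified; four colours on every [−1]-free pattern; five on every covered S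
    (∀ S : Finset ℕ, (∀ d ∈ S, d % 4 ≠ 0) →
        ((planeUnitDistanceGraph.induce (fieldPoints (multiSqrtField S))).Colorable 2 ↔
          SquareClassesAvoidNegOneAndThree S)) ∧
    (∀ S : Finset ℕ, SquareClassesAvoidNegOne S →
        (planeUnitDistanceGraph.induce (fieldPoints (multiSqrtField S))).Colorable 4) ∧
    (∀ S : Finset ℕ, Covered S → (planeUnitDistanceGraph.induce (fieldPoints (multiSqrtField S))).Colorable 5) ∧
    -- census: where a 6-chromatic witness cannot live
    (∀ (V : Type) (G : SimpleGraph V) (q : V → EuclideanSpace ℝ (Fin 2)), IsUnitDistanceRealisation G q →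
        ¬ G.Colorable 5 →
          (∃ v i, q v i ∉ multiSqrtField {3, 5, 11}) ∧
          (∀ d ∈ Finset.range 167, d ≠ 0 → d ≠ 164 → ∃ v i, q v i ∉ multiSqrtField {d}) ∧
          (∀ a ∈ squarefree30, ∀ b ∈ squarefree30, a < b → (a, b) ∉ biquadraticSurvivors30 →
            ∃ v i, q v i ∉ multiSqrtField {a, b})) := by
  refine ⟨chromaticNumber_plane_cases, chromaticNumber_plane_sqrt_eq_two_iff, chromaticNumber_plane_sqrt_eq_three,
    colorable_two_plane_iff, colorable_four_plane_of_squareClasses, colorable_five_plane_of_covered, ?_⟩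
  intro V G q hq h5
  refine ⟨sixChromatic_witness_leaves_heuleField hq h5, ?_, ?_⟩
  · intro d hd hd0 hd164
    exact sixChromatic_witness_leaves_covered hq h5 _ (quadratic_covered_lt_167 d hd hd0 hd164)
  · intro a ha b hb hab hs
    exact sixChromatic_witness_leaves_biquadratic_30 hq h5 ha hb hab hs

end Summit.Ventures.DiscreteObjects.UnitDistance
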